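import Literature.Barriers.RiemannHypothesis.EpsteinZetaRealZeros
import HarnessLib

/-!
# Sublattice identities between the Epstein zeta functions of discriminant `−15` and `−60`

Topic `NumberTheory/QuadraticFields`, namespace
`Literature.NumberTheory.QuadraticFields.ChowlaSelbergFifteen` (the arithmetic bookkeeping of the
Chowla–Selberg evaluation at `D = −15` behind
`Literature.Analysis.FunctionSpaces.BorweinStraubWanZudilin2012_eq_5_3`). Everything here is
PROVED (theorems only; no definitions, no named facts).

Write `Q₁ = x² + xy + 4y²`, `Q₂ = 2x² + xy + 2y²` (the two reduced forms of discriminant `−15`),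
`Q₃ = x² + 15y²` (the principal form of discriminant `−60`), and `Z_j(s) = Σ'_{(x,y)} Q_j(x,y)^{−s}`
for the tree's `Literature.Barriers.RiemannHypothesis.epsteinZeta`. Elementary changes of
variables inside `ℤ²` give:

* `tsum_dvd_five_Q₁` — **`Σ'_{5 ∣ Q₁(x,y)} Q₁(x,y)^{−s} = 5^{−s} Z₂(s)`**: `5 ∣ Q₁(x,y) ⟺ x ≡ 2y (5)`
  (`(x − 2y)² = Q₁ − 5xy`), and `(u,v) ↦ (2u + 3v, u − v)` maps `ℤ²` onto this sublattice with
  `Q₁(2u+3v, u−v) = 5 Q₂(u,v)`;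
* `tsum_dvd_five_Q₂` — **`Σ'_{5 ∣ Q₂(x,y)} Q₂(x,y)^{−s} = 5^{−s} Z₁(s)`**: `5 ∣ Q₂ ⟺ x ≡ y (5)`
  (`Q₂ = 2(x−y)² + 5xy`), `(u,v) ↦ (u − 2v, u + 3v)`, `Q₂(u−2v, u+3v) = 5 Q₁(u,v)`
  (these two feed the genus-character computation `Z₁ − Z₂ = 2L(s,χ₋₃)L(s,χ₅)` through the twist
  by `χ₅`, since `𝔭₅` lies in the non-principal class);
* `epsteinZeta_one_zero_fifteen` — **`Z₃(s) = (1 + 2·4^{−s}) Z₁(s) − 2·2^{−s} Z₂(s)`** for `Re s > 1`: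
  the three sublattices of index `2` of `ℤ²` carry `Q₁` to `2Q₂` (`x` even: `(2u, v)`), to `Q₃`
  (`y` even: `(u − v, 2v)`, `Q₁(u−v,2v) = u² + 15v²`) and to `2Q₂` (`x ≡ y (2)`: `(−u−2v, u)`),
  they intersect in `2ℤ²` (`Q₁ ↦ 4Q₁`), and `1 = [2∣x] + [2∣y] + [x ≡ y] − 2[2∣x][2∣y]` pointwise
  (so the Kronecker-limit constant of `Q₃` is `(3/2)C₁ − C₂` in terms of those of `Q₁, Q₂`).

These are the index-`2` and index-`5` instances of the classical relations between Epstein zeta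
functions of a lattice and its sublattices (Siegel, *Advanced Analytic Number Theory*, Ch. II §3;
for `D = −15`: Zucker–Robertson, "Exact values of some two-dimensional lattice sums", J. Phys. A 8
(1975), Table), written out for the tree's `tsum`-typed `epsteinZeta` with no appeal to the theory
of orders.

## References

* C. L. Siegel, *Advanced Analytic Number Theory*, TIFR / Springer (1980), Ch. II §3.
* I. J. Zucker, M. M. Robertson, Exact values of some two-dimensional lattice sums,
  J. Phys. A 8 (1975) 874–881.
-/

noncomputable section

open Complex Filter Topology
open Literature.Barriers.RiemannHypothesis

namespace Literature.NumberTheory.QuadraticFields.ChowlaSelbergFifteen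

/-! ### Reindexing a lattice sum along an injective change of variables -/

/-- `Σ_{p ∈ S} f(p) = Σ_u f(φ(u))` when `φ : ℤ² → ℤ²` is injective with range `S`
(unconditionally, for Mathlib's `tsum`). [folklore] -/
theorem tsum_indicator_eq_tsum_comp {φ : ℤ × ℤ → ℤ × ℤ} (hφ : Function.Injective φ)
    {S : Set (ℤ × ℤ)} (hS : Set.range φ = S) (f : ℤ × ℤ → ℂ) :
    ∑' p, S.indicator f p = ∑' u, f (φ u) := by
  rw [← tsum_subtype, ← tsum_range f hφ]
  exact tsum_congr_set_coe f hS.symm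

/-- Change of variables in an Epstein term: if `Q(φ(u)) = k · Q'(u)` (`k > 0`) and `φ(u) = 0 ⟺ u = 0`,
then `Q(φ u)^{−s} = k^{−s} Q'(u)^{−s}` termwise (with the convention `0` at the origin). [folklore] -/
theorem epsteinTerm_comp {a b c a' b' c' k : ℝ} (hk : 0 < k) (hQ' : IsPosDefForm a' b' c')
    {φ : ℤ × ℤ → ℤ × ℤ} (h0 : ∀ u, φ u = 0 ↔ u = 0)
    (hval : ∀ u, bqfEval a b c (φ u) = k * bqfEval a' b' c' u) (s : ℂ) (u : ℤ × ℤ) :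
    epsteinTerm a b c s (φ u) = (k : ℂ) ^ (-s) * epsteinTerm a' b' c' s u := by
  unfold epsteinTerm
  by_cases hu : u = 0
  · rw [if_pos ((h0 u).2 hu), if_pos hu, mul_zero]
  · rw [if_neg (fun h => hu ((h0 u).1 h)), if_neg hu, hval u, Complex.ofReal_mul,
      Complex.mul_cpow_ofReal_nonneg hk.le (hQ'.eval_pos hu).le]

/-- The general reindexing identity: `Σ'_{p ∈ range φ} Q(p)^{−s} = k^{−s} Z_{Q'}(s)`. [folklore] -/
theorem tsum_indicator_epsteinTerm_eq {a b c a' b' c' k : ℝ} (hk : 0 < k) (hQ' : IsPosDefForm a' b' c')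
    {φ : ℤ × ℤ → ℤ × ℤ} (hφ : Function.Injective φ) {S : Set (ℤ × ℤ)} (hS : Set.range φ = S)
    (h0 : ∀ u, φ u = 0 ↔ u = 0) (hval : ∀ u, bqfEval a b c (φ u) = k * bqfEval a' b' c' u) (s : ℂ) :
    ∑' p, S.indicator (epsteinTerm a b c s) p = (k : ℂ) ^ (-s) * epsteinZeta a' b' c' s := by
  rw [tsum_indicator_eq_tsum_comp hφ hS, epsteinZeta, ← tsum_mul_left]
  exact tsum_congr fun u => epsteinTerm_comp hk hQ' h0 hval s u

/-- A map `φ` with `φ 0 = 0` which is injective has `φ u = 0 ⟺ u = 0`. [folklore] -/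
theorem map_eq_zero_iff {φ : ℤ × ℤ → ℤ × ℤ} (hφ : Function.Injective φ) (h0 : φ 0 = 0) (u : ℤ × ℤ) :
    φ u = 0 ↔ u = 0 :=
  ⟨fun h => hφ (h.trans h0.symm), fun h => h ▸ h0⟩

/-! ### The three forms -/

/-- `x² + xy + 4y²` is positive definite. [folklore] -/
theorem isPosDefForm_Q₁ : IsPosDefForm 1 1 4 := ⟨by norm_num, by norm_num⟩

/-- `2x² + xy + 2y²` is positive definite. [folklore] -/
theorem isPosDefForm_Q₂ : IsPosDefForm 2 1 2 := ⟨by norm_num, by norm_num⟩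

/-- `x² + 15y²` is positive definite. [folklore] -/
theorem isPosDefForm_Q₃ : IsPosDefForm 1 0 15 := ⟨by norm_num, by norm_num⟩

/-! ### The sublattice `5 ∣ Q₁`: `Σ'_{5∣Q₁} Q₁^{−s} = 5^{−s} Z₂` -/

/-- `5 ∣ x² + xy + 4y²` iff `5 ∣ x − 2y` (`(x − 2y)² = Q₁(x,y) − 5xy`). [folklore] -/
theorem five_dvd_Q₁_iff (x y : ℤ) : (5 : ℤ) ∣ x ^ 2 + x * y + 4 * y ^ 2 ↔ (5 : ℤ) ∣ x - 2 * y := by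
  have h5 : Prime (5 : ℤ) := by norm_num
  constructor
  · intro h
    have hsq : (5 : ℤ) ∣ (x - 2 * y) ^ 2 := by
      have : (x - 2 * y) ^ 2 = (x ^ 2 + x * y + 4 * y ^ 2) - 5 * (x * y) := by ring
      rw [this]
      exact dvd_sub h (dvd_mul_right 5 _)
    exact h5.dvd_of_dvd_pow hsq
  · rintro ⟨w, hw⟩
    have hx : x = 2 * y + 5 * w := by linarith
    subst hx
    exact ⟨2 * y ^ 2 + 5 * y * w + 5 * w ^ 2, by ring⟩

/-- The change of variables `(u,v) ↦ (2u + 3v, u − v)` onto `{5 ∣ Q₁}`. [folklore] -/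
theorem range_phi₁ :
    Set.range (fun u : ℤ × ℤ => (2 * u.1 + 3 * u.2, u.1 - u.2)) =
      {p : ℤ × ℤ | (5 : ℤ) ∣ p.1 ^ 2 + p.1 * p.2 + 4 * p.2 ^ 2} := by
  ext ⟨x, y⟩
  simp only [Set.mem_range, Set.mem_setOf_eq, Prod.mk.injEq, five_dvd_Q₁_iff]
  constructor
  · rintro ⟨⟨u, v⟩, h1, h2⟩
    exact ⟨v, by simp only at h1 h2; linarith⟩
  · rintro ⟨w, hw⟩
    exact ⟨(y + w, w), show (2 * (y + w) + 3 * w = x) ∧ (y + w - w = y) from ⟨by omega, by omega⟩⟩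

/-- **`Σ'_{5 ∣ Q₁(x,y)} Q₁(x,y)^{−s} = 5^{−s} Z₂(s)`** (all `s`): the points with `5 ∣ Q₁` are
`(2u+3v, u−v)`, `(u,v) ∈ ℤ²`, and `Q₁(2u+3v, u−v) = 5(2u² + uv + 2v²)`.
[folklore] -/
theorem tsum_dvd_five_Q₁ (s : ℂ) :
    ∑' p : ℤ × ℤ, {p : ℤ × ℤ | (5 : ℤ) ∣ p.1 ^ 2 + p.1 * p.2 + 4 * p.2 ^ 2}.indicator
        (epsteinTerm 1 1 4 s) p = (5 : ℂ) ^ (-s) * epsteinZeta 2 1 2 s := by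
  have hφ : Function.Injective (fun u : ℤ × ℤ => (2 * u.1 + 3 * u.2, u.1 - u.2)) := by
    rintro ⟨a, b⟩ ⟨c, d⟩ h
    simp only [Prod.mk.injEq] at h ⊢
    omega
  have hval : ∀ u : ℤ × ℤ, bqfEval 1 1 4 ((fun u : ℤ × ℤ => (2 * u.1 + 3 * u.2, u.1 - u.2)) u) =
      5 * bqfEval 2 1 2 u := fun u => by
    simp only [bqfEval]; push_cast; ring
  have h := tsum_indicator_epsteinTerm_eq (by norm_num : (0 : ℝ) < 5) isPosDefForm_Q₂ hφ range_phi₁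
    (map_eq_zero_iff hφ (by simp)) hval s
  exact_mod_cast h

/-! ### The sublattice `5 ∣ Q₂`: `Σ'_{5∣Q₂} Q₂^{−s} = 5^{−s} Z₁` -/

/-- `5 ∣ 2x² + xy + 2y²` iff `5 ∣ x − y` (`Q₂ = 2(x − y)² + 5xy`). [folklore] -/
theorem five_dvd_Q₂_iff (x y : ℤ) : (5 : ℤ) ∣ 2 * x ^ 2 + x * y + 2 * y ^ 2 ↔ (5 : ℤ) ∣ x - y := by
  have h5 : Prime (5 : ℤ) := by norm_num
  constructor
  · intro h
    have h2sq : (5 : ℤ) ∣ 2 * (x - y) ^ 2 := by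
      have : 2 * (x - y) ^ 2 = (2 * x ^ 2 + x * y + 2 * y ^ 2) - 5 * (x * y) := by ring
      rw [this]
      exact dvd_sub h (dvd_mul_right 5 _)
    have hsq : (5 : ℤ) ∣ (x - y) ^ 2 := by
      rcases h5.dvd_or_dvd h2sq with h2 | h2
      · norm_num at h2
      · exact h2
    exact h5.dvd_of_dvd_pow hsq
  · rintro ⟨w, hw⟩
    have hx : x = y + 5 * w := by linarith
    subst hx
    exact ⟨y ^ 2 + 5 * y * w + 10 * w ^ 2, by ring⟩

/-- The change of variables `(u,v) ↦ (u − 2v, u + 3v)` onto `{5 ∣ Q₂}`. [folklore] -/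
theorem range_phi₂ :
    Set.range (fun u : ℤ × ℤ => (u.1 - 2 * u.2, u.1 + 3 * u.2)) =
      {p : ℤ × ℤ | (5 : ℤ) ∣ 2 * p.1 ^ 2 + p.1 * p.2 + 2 * p.2 ^ 2} := by
  ext ⟨x, y⟩
  simp only [Set.mem_range, Set.mem_setOf_eq, Prod.mk.injEq, five_dvd_Q₂_iff]
  constructor
  · rintro ⟨⟨u, v⟩, h1, h2⟩
    exact ⟨-v, by simp only at h1 h2; linarith⟩
  · rintro ⟨w, hw⟩
    exact ⟨(x - 2 * w, -w), show (x - 2 * w - 2 * (-w) = x) ∧ (x - 2 * w + 3 * (-w) = y) from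
      ⟨by omega, by omega⟩⟩

/-- **`Σ'_{5 ∣ Q₂(x,y)} Q₂(x,y)^{−s} = 5^{−s} Z₁(s)`** (all `s`): the points with `5 ∣ Q₂` are
`(u−2v, u+3v)`, and `Q₂(u−2v, u+3v) = 5(u² + uv + 4v²)`.
[folklore] -/
theorem tsum_dvd_five_Q₂ (s : ℂ) :
    ∑' p : ℤ × ℤ, {p : ℤ × ℤ | (5 : ℤ) ∣ 2 * p.1 ^ 2 + p.1 * p.2 + 2 * p.2 ^ 2}.indicator
        (epsteinTerm 2 1 2 s) p = (5 : ℂ) ^ (-s) * epsteinZeta 1 1 4 s := by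
  have hφ : Function.Injective (fun u : ℤ × ℤ => (u.1 - 2 * u.2, u.1 + 3 * u.2)) := by
    rintro ⟨a, b⟩ ⟨c, d⟩ h
    simp only [Prod.mk.injEq] at h ⊢
    omega
  have hval : ∀ u : ℤ × ℤ, bqfEval 2 1 2 ((fun u : ℤ × ℤ => (u.1 - 2 * u.2, u.1 + 3 * u.2)) u) =
      5 * bqfEval 1 1 4 u := fun u => by
    simp only [bqfEval]; push_cast; ring
  have h := tsum_indicator_epsteinTerm_eq (by norm_num : (0 : ℝ) < 5) isPosDefForm_Q₁ hφ range_phi₂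
    (map_eq_zero_iff hφ (by simp)) hval s
  exact_mod_cast h

/-! ### The index-`2` sublattices and `Z₃ = (1 + 2·4^{−s})Z₁ − 2·2^{−s}Z₂` -/

/-- `x` even: `Σ'_{2∣x} Q₁^{−s} = 2^{−s} Z₂` via `(u,v) ↦ (2u, v)`, `Q₁(2u,v) = 2Q₂(u,v)`. [folklore] -/
theorem tsum_even_fst_Q₁ (s : ℂ) :
    ∑' p : ℤ × ℤ, {p : ℤ × ℤ | (2 : ℤ) ∣ p.1}.indicator (epsteinTerm 1 1 4 s) p =
      (2 : ℂ) ^ (-s) * epsteinZeta 2 1 2 s := by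
  have hφ : Function.Injective (fun u : ℤ × ℤ => (2 * u.1, u.2)) := by
    rintro ⟨a, b⟩ ⟨c, d⟩ h
    simp only [Prod.mk.injEq] at h ⊢
    omega
  have hS : Set.range (fun u : ℤ × ℤ => (2 * u.1, u.2)) = {p : ℤ × ℤ | (2 : ℤ) ∣ p.1} := by
    ext ⟨x, y⟩
    simp only [Set.mem_range, Set.mem_setOf_eq, Prod.mk.injEq]
    constructor
    · rintro ⟨⟨u, v⟩, h1, -⟩
      exact ⟨u, by simp only at h1; linarith⟩
    · rintro ⟨w, hw⟩
      exact ⟨(w, y), show 2 * w = x ∧ y = y from ⟨by omega, rfl⟩⟩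
  have hval : ∀ u : ℤ × ℤ, bqfEval 1 1 4 ((fun u : ℤ × ℤ => (2 * u.1, u.2)) u) =
      2 * bqfEval 2 1 2 u := fun u => by
    simp only [bqfEval]; push_cast; ring
  have h := tsum_indicator_epsteinTerm_eq (by norm_num : (0 : ℝ) < 2) isPosDefForm_Q₂ hφ hS
    (map_eq_zero_iff hφ (by simp)) hval s
  exact_mod_cast h

/-- `y` even: `Σ'_{2∣y} Q₁^{−s} = Z₃` via `(u,v) ↦ (u − v, 2v)`, `Q₁(u−v, 2v) = u² + 15v²`. [folklore] -/
theorem tsum_even_snd_Q₁ (s : ℂ) :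
    ∑' p : ℤ × ℤ, {p : ℤ × ℤ | (2 : ℤ) ∣ p.2}.indicator (epsteinTerm 1 1 4 s) p =
      epsteinZeta 1 0 15 s := by
  have hφ : Function.Injective (fun u : ℤ × ℤ => (u.1 - u.2, 2 * u.2)) := by
    rintro ⟨a, b⟩ ⟨c, d⟩ h
    simp only [Prod.mk.injEq] at h ⊢
    omega
  have hS : Set.range (fun u : ℤ × ℤ => (u.1 - u.2, 2 * u.2)) = {p : ℤ × ℤ | (2 : ℤ) ∣ p.2} := by
    ext ⟨x, y⟩
    simp only [Set.mem_range, Set.mem_setOf_eq, Prod.mk.injEq]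
    constructor
    · rintro ⟨⟨u, v⟩, -, h2⟩
      exact ⟨v, by simp only at h2; linarith⟩
    · rintro ⟨w, hw⟩
      exact ⟨(x + w, w), show (x + w - w = x) ∧ 2 * w = y from ⟨by omega, by omega⟩⟩
  have hval : ∀ u : ℤ × ℤ, bqfEval 1 1 4 ((fun u : ℤ × ℤ => (u.1 - u.2, 2 * u.2)) u) =
      1 * bqfEval 1 0 15 u := fun u => by
    simp only [bqfEval]; push_cast; ring
  have h := tsum_indicator_epsteinTerm_eq (by norm_num : (0 : ℝ) < 1) isPosDefForm_Q₃ hφ hS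
    (map_eq_zero_iff hφ (by simp)) hval s
  rw [h]
  simp

/-- `x ≡ y (mod 2)`: `Σ'_{2∣x−y} Q₁^{−s} = 2^{−s} Z₂` via `(u,v) ↦ (−u − 2v, u)`,
`Q₁(−u−2v, u) = 2Q₂(u,v)`. [folklore] -/
theorem tsum_even_sub_Q₁ (s : ℂ) :
    ∑' p : ℤ × ℤ, {p : ℤ × ℤ | (2 : ℤ) ∣ p.1 - p.2}.indicator (epsteinTerm 1 1 4 s) p =
      (2 : ℂ) ^ (-s) * epsteinZeta 2 1 2 s := by
  have hφ : Function.Injective (fun u : ℤ × ℤ => (-u.1 - 2 * u.2, u.1)) := by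
    rintro ⟨a, b⟩ ⟨c, d⟩ h
    simp only [Prod.mk.injEq] at h ⊢
    omega
  have hS : Set.range (fun u : ℤ × ℤ => (-u.1 - 2 * u.2, u.1)) = {p : ℤ × ℤ | (2 : ℤ) ∣ p.1 - p.2} := by
    ext ⟨x, y⟩
    simp only [Set.mem_range, Set.mem_setOf_eq, Prod.mk.injEq]
    constructor
    · rintro ⟨⟨u, v⟩, h1, h2⟩
      exact ⟨-u - v, by simp only at h1 h2; linarith⟩
    · rintro ⟨w, hw⟩
      exact ⟨(y, -w - y), show (-y - 2 * (-w - y) = x) ∧ y = y from ⟨by omega, rfl⟩⟩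
  have hval : ∀ u : ℤ × ℤ, bqfEval 1 1 4 ((fun u : ℤ × ℤ => (-u.1 - 2 * u.2, u.1)) u) =
      2 * bqfEval 2 1 2 u := fun u => by
    simp only [bqfEval]; push_cast; ring
  have h := tsum_indicator_epsteinTerm_eq (by norm_num : (0 : ℝ) < 2) isPosDefForm_Q₂ hφ hS
    (map_eq_zero_iff hφ (by simp)) hval s
  exact_mod_cast h

/-- Both even: `Σ'_{2∣x, 2∣y} Q₁^{−s} = 4^{−s} Z₁` via `(u,v) ↦ (2u, 2v)`. [folklore] -/
theorem tsum_even_even_Q₁ (s : ℂ) :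
    ∑' p : ℤ × ℤ, {p : ℤ × ℤ | (2 : ℤ) ∣ p.1 ∧ (2 : ℤ) ∣ p.2}.indicator (epsteinTerm 1 1 4 s) p =
      (4 : ℂ) ^ (-s) * epsteinZeta 1 1 4 s := by
  have hφ : Function.Injective (fun u : ℤ × ℤ => (2 * u.1, 2 * u.2)) := by
    rintro ⟨a, b⟩ ⟨c, d⟩ h
    simp only [Prod.mk.injEq] at h ⊢
    omega
  have hS : Set.range (fun u : ℤ × ℤ => (2 * u.1, 2 * u.2)) =
      {p : ℤ × ℤ | (2 : ℤ) ∣ p.1 ∧ (2 : ℤ) ∣ p.2} := by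
    ext ⟨x, y⟩
    simp only [Set.mem_range, Set.mem_setOf_eq, Prod.mk.injEq]
    constructor
    · rintro ⟨⟨u, v⟩, h1, h2⟩
      exact ⟨⟨u, by simp only at h1; linarith⟩, ⟨v, by simp only at h2; linarith⟩⟩
    · rintro ⟨⟨w, hw⟩, ⟨z, hz⟩⟩
      exact ⟨(w, z), show 2 * w = x ∧ 2 * z = y from ⟨by omega, by omega⟩⟩
  have hval : ∀ u : ℤ × ℤ, bqfEval 1 1 4 ((fun u : ℤ × ℤ => (2 * u.1, 2 * u.2)) u) =
      4 * bqfEval 1 1 4 u := fun u => by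
    simp only [bqfEval]; push_cast; ring
  have h := tsum_indicator_epsteinTerm_eq (by norm_num : (0 : ℝ) < 4) isPosDefForm_Q₁ hφ hS
    (map_eq_zero_iff hφ (by simp)) hval s
  exact_mod_cast h

/-- The inclusion–exclusion of indicators for the three index-`2` sublattices of `ℤ²`:
`f = [2∣x]f + [2∣y]f + [2∣x−y]f − 2[2∣x ∧ 2∣y]f` pointwise. [folklore] -/
theorem indicator_identity (f : ℤ × ℤ → ℂ) (p : ℤ × ℤ) :
    f p = {p : ℤ × ℤ | (2 : ℤ) ∣ p.1}.indicator f p + {p : ℤ × ℤ | (2 : ℤ) ∣ p.2}.indicator f p +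
      {p : ℤ × ℤ | (2 : ℤ) ∣ p.1 - p.2}.indicator f p -
        2 * {p : ℤ × ℤ | (2 : ℤ) ∣ p.1 ∧ (2 : ℤ) ∣ p.2}.indicator f p := by
  obtain ⟨x, y⟩ := p
  simp only [Set.indicator_apply, Set.mem_setOf_eq]
  by_cases hx : (2 : ℤ) ∣ x <;> by_cases hy : (2 : ℤ) ∣ y
  · have hxy : (2 : ℤ) ∣ x - y := dvd_sub hx hy
    simp [hx, hy, hxy]; ring
  · have hxy : ¬ (2 : ℤ) ∣ x - y := fun h => hy (by have := dvd_sub hx h; simpa using this)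
    simp [hx, hy, hxy]
  · have hxy : ¬ (2 : ℤ) ∣ x - y := fun h => hx (by have := dvd_add h hy; simpa using this)
    simp [hx, hy, hxy]
  · have hxy : (2 : ℤ) ∣ x - y := by
      rw [Int.two_dvd_ne_zero] at hx hy
      omega
    simp [hx, hy, hxy]

/-- **`Z₃(s) = (1 + 2·4^{−s}) Z₁(s) − 2·2^{−s} Z₂(s)`** for `Re s > 1`, where
`Z₁ = Z_{(1,1,4)}`, `Z₂ = Z_{(2,1,2)}` (discriminant `−15`) and `Z₃ = Z_{(1,0,15)}` (discriminant
`−60`): the lattice sum of `Q₁` splits over the three sublattices of index `2`, which carry `Q₁`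
to `2Q₂`, `Q₃`, `2Q₂` and meet in `2ℤ²` (`4Q₁`).
[folklore] -/
theorem epsteinZeta_one_zero_fifteen {s : ℂ} (hs : 1 < s.re) :
    epsteinZeta 1 0 15 s =
      (1 + 2 * (4 : ℂ) ^ (-s)) * epsteinZeta 1 1 4 s - 2 * (2 : ℂ) ^ (-s) * epsteinZeta 2 1 2 s := by
  set f := epsteinTerm 1 1 4 s with hf
  have hsum : Summable f := (summable_norm_epsteinTerm isPosDefForm_Q₁ hs).of_norm
  have hA := hsum.indicator {p : ℤ × ℤ | (2 : ℤ) ∣ p.1}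
  have hB := hsum.indicator {p : ℤ × ℤ | (2 : ℤ) ∣ p.2}
  have hC := hsum.indicator {p : ℤ × ℤ | (2 : ℤ) ∣ p.1 - p.2}
  have hD := hsum.indicator {p : ℤ × ℤ | (2 : ℤ) ∣ p.1 ∧ (2 : ℤ) ∣ p.2}
  have hZ1 : epsteinZeta 1 1 4 s = ∑' p, f p := rfl
  have hsplit : ∑' p, f p =
      ∑' p, {p : ℤ × ℤ | (2 : ℤ) ∣ p.1}.indicator f p + ∑' p, {p : ℤ × ℤ | (2 : ℤ) ∣ p.2}.indicator f p +
        ∑' p, {p : ℤ × ℤ | (2 : ℤ) ∣ p.1 - p.2}.indicator f p -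
          2 * ∑' p, {p : ℤ × ℤ | (2 : ℤ) ∣ p.1 ∧ (2 : ℤ) ∣ p.2}.indicator f p := by
    rw [← tsum_mul_left, ← hA.tsum_add hB, ← (hA.add hB).tsum_add hC,
      ← ((hA.add hB).add hC).tsum_sub (hD.mul_left 2)]
    exact tsum_congr fun p => indicator_identity f p
  rw [hf, tsum_even_fst_Q₁, tsum_even_snd_Q₁, tsum_even_sub_Q₁, tsum_even_even_Q₁] at hsplit
  rw [hZ1, hf] at *
  linear_combination (-1 : ℂ) * hsplit

end Literature.NumberTheory.QuadraticFields.ChowlaSelbergFifteen
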